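import Literature.NumberTheory.LFunctions.ExceptionalCharacterSmallSplitPrimes
import Literature.NumberTheory.LFunctions.RealZerosPintzContinuation
import Literature.NumberTheory.QuadraticFields.KroneckerSplitting
import Literature.NumberTheory.QuadraticFields.FundamentalDiscriminant
import Mathlib.Analysis.SpecialFunctions.Pow.Asymptotics
import HarnessLib

/-!
# The unconditional CEILING for the split primes of a real character, explicit:
# `#{p ≤ t : χ(p) ≠ −1} ≤ L(1,χ)·t + 5·√(√q(1+log q)·t)` (Pintz's «most small primes are inert», in
# count form) and `N_q(P) ≤ (π/2)·h(−q)·P/√q + (5/2)·√(√q(1+log q)·P)` on Dunn–Kerr–Shparlinski–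
# Zaharescu's window

Topic `Literature/NumberTheory/LFunctions` (character-level theorems in the grouping sub-namespace
`SplitPrimeCeiling`; field-level corollaries appended to `DKSZ2020` of
`ExceptionalCharacterSmallSplitPrimes.lean`). Everything here is PROVED (theorems only; no definition,
no named fact, debt 0). Cell `parity-realchar` (SIEGEL INSTRUMENT, conditionals column, topic I.18
«prime splitting in the exceptional quadratic field»): the KERNEL companion of the topic's two printed
illusory statements — Pintz 1976 (II) Theorems 4–5 ("`L(1,χ) ≤ 1/log²D` … shows that for the most
primes `p ≤ D²`, `χ(p) = −1`"; named facts `pintz1976_theorem4/5`, in the finer `Σ(1+χ(p))/p`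
currency) and Dunn–Kerr–Shparlinski–Zaharescu 2020 Theorem 5 (`N_q(P) ≥ c(ε)h(−q)P/(√q(log q)²)` for
`q^{1/2+ε} ≤ P ≤ q` under `L(1,χ_{−q}) = O((log q)^{−10})`; named fact `dksz2020_theorem5`) — namely
the UPPER bound which the hyperbola main term `L(1,χ)·t` imposes UNCONDITIONALLY. With `r = 1 ∗ χ ≥ 0`
(`RealChar.charDivisorSum`), `r(1) = 1`, `r(p) = 1 + χ(p)`:
`1 + #{p ≤ t : χ(p) ≠ −1} + #{p ≤ t : χ(p) = 1} ≤ Σ_{n ≤ t} r(n) ≤ L(1,χ)·t + 5√(A t)` for `t ≥ A`,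
`A = √q(1 + log q)` the tree's Pólya–Vinogradov bound, the last step being Pintz's Lemma 1 (`j = 1`)
at Pólya–Vinogradov strength as PROVED in the tree by the `landau-siegel` cell
(`Pintz1977RealZeros.abs_sum_charDivisorSum_sub_le_of_partialSum_le`).

* `SplitPrimeCeiling.sum_charDivisorSum_le` — `Σ_{n ≤ t} r(n) ≤ Re L(1,χ)·t + 5√(A t)` (`χ` primitive
  mod `q ≥ 2`, `t ≥ A`);
* `SplitPrimeCeiling.card_primes_not_inert_le` — **`#{p ≤ t prime : χ(p) ≠ −1} ≤ Re L(1,χ)·t +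
  5√(A t)`** (`χ` primitive quadratic): all but `L(1,χ)·t + O(q^{1/4}√(t log q))` of the primes `p ≤ t`
  are INERT — non-trivial exactly in the illusory regime `L(1,χ) = o(1/log t)`;
* `SplitPrimeCeiling.card_primes_split_le` — `#{p ≤ t prime : χ(p) = 1} ≤ Re L(1,χ)·t/2 + (5/2)√(A t)`;
  `…_of_norm_LFunction_one_le` — under `‖L(1,χ)‖ ≤ C/(log q)^B` (Pintz's (1.25): `C = 1, B = 2`;
  DKSZ's (1.5): `B = 10`) the bound `C·t/(2(log q)^B) + (5/2)√(A t)`; `…_of_isSiegelZero` — on the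
  column's zero-side predicate (Tao–Teräväinen `IsSiegelZero χ η`, `η ≥ 40`, `q ≥ 232`; kernel (11.10)
  `‖L(1,χ)‖ log q ≤ (log q)²/η`): `(log q/η)·t/2 + (5/2)√(A t)` — a Siegel zero of quality
  `η ≫ log q · log t` leaves a vanishing proportion of the primes `p ≤ t` split;
* `DKSZ2020.splitPrimeCount_eq_card` — the decomposition law as a COUNT identity for a quadratic field
  with odd `d_K`: `#{p ≤ P : p splits in 𝓞_K} = #{p ≤ P prime : χ(p) = 1}`, `χ = jacobiChar |d_K|`
  (tree: `Quadratic.ncard_primesOver_eq_two_iff_jacobiSym`, `ncard_primesOver_two_eq_two_iff`,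
  reciprocity `jacobiSym_natAbs_eq_of_emod_four_eq_one`, supplement `jacobiSym_two_natAbs_eq_one_iff`);
* `DKSZ2020.splitPrimeCount_le` — **odd `d_K = −q < −4`, `P ≥ √q(1+log q)`:
  `N_q(P) ≤ (π h_K/(2√q))·P + (5/2)√(A P)`** (class number formula `L(1,χ) = π h_K/√q`, `w_K = 2`);
  `…_of_isSiegelZero` (`π h_K/√q` replaced by `log q/η`);
* `DKSZ2020.splitPrimeCount_two_sided` — Theorem 5 and the ceiling on ONE window (modulo the named fact;
  the side condition `√q(1+log q) ≤ q^{1/2+ε}`, `q ≥ q₁(ε)`, is discharged): `∀ ε > 0, ∀ C, ∃ c > 0,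
  ∃ q₀`: `c·h_K·P/(√q log²q) ≤ N_q(P) ≤ (C/2)·P/(log q)^{10} + (5/2)√(A P)` for primes `q ≥ q₀`,
  `q ≡ 3 (4)`, `d_K = −q`, `‖L(1,χ)‖ ≤ C/(log q)^{10}`, `q^{1/2+ε} ≤ P ≤ q`. READING: DKSZ's illusory
  lower bound is within the factor `(π/(2c))(log q)²` of an unconditional kernel ceiling; under (1.5)
  at most `(C/2)P/(log q)^{10} + O(q^{1/4}√(P log q))` of the `≳ P/log q` primes `p ≤ P` split —
  Pintz's phenomenon with explicit constants on DKSZ's own window.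

presearch: the count-form ceiling is folklore (first display of Pintz 1976 II §5 / DKSZ §5.3 read
upward); the tree held it at trivial strength only (error `5q√N`:
`Literature.Barriers.Parity.Motohashi1979.two_mul_card_splitPrimes_le_convSum` with
`ZetaMul.abs_convSum_sub_le`, void on `P ≤ q`); the Pólya–Vinogradov strength is what DKSZ's window needs.

LABEL (cell rule): instrument (kernel) / conditionals companion. WHAT THIS IS NOT: no lower bound for
split primes is proved (Theorem 5 stays a named fact); no claim that an exceptional character exists;
nothing here bears on the parity summit.

## References

* [Pintz1976ElementaryII] J. Pintz, Acta Arith. 31 (1976) 273–289: Theorems 4–5 pp. 277–279, §5.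
* [Pintz1977ElementaryVIII] J. Pintz, Acta Arith. 33 (1977) 89–98: Lemma 1 (3.9) p. 92.
* [DunnKerrShparlinskiZaharescu2020] A. Dunn, B. Kerr, I. E. Shparlinski, A. Zaharescu, Adv. Math. 375
  (2020) 107369: §1.1 (`N_q(P)`), §1.2 Theorem 5, §5.3.
* [MontgomeryVaughan2007] §9.4 (Pólya–Vinogradov); §11.2 Theorem 11.4 (11.10).
* [NeukirchANT1999] Ch. I §8 Prop. 8.5 (decomposition law); Ch. VII §5 (5.11) (class number formula).
* [TaoTeravainen2021] Definition 1.4 (`IsSiegelZero`).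
-/
noncomputable section

open Finset
open Literature.Barriers.Parity
open Literature.NumberTheory.QuadraticFields Literature.NumberTheory.QuadraticFields.Quadratic
open _root_.NumberField _root_.NumberField.Units Module Ideal

namespace Literature.NumberTheory.LFunctions

/-! ## Part 1. Character level: the hyperbola ceiling at Pólya–Vinogradov strength -/

namespace SplitPrimeCeiling

open DirichletAbel RealChar Pintz1977RealZeros

variable {q : ℕ} [NeZero q] (χ : DirichletCharacter ℂ q)

omit [NeZero q] in
/-- The Pólya–Vinogradov constant `A = √q (1 + log q)` is `≥ 1` for `q ≥ 2`. [folklore] -/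
private theorem one_le_pv (hq : 2 ≤ q) : 1 ≤ Real.sqrt q * (1 + Real.log q) := by
  have hq1 : (1 : ℝ) ≤ q := by exact_mod_cast (show 1 ≤ q by omega)
  have h1 : 1 ≤ Real.sqrt q := by simpa using Real.sqrt_le_sqrt hq1
  nlinarith [Real.log_nonneg hq1]

/-- **The hyperbola ceiling at Pólya–Vinogradov strength.** For a primitive character `χ` mod `q ≥ 2`
(`r(n) = Σ_{d∣n} Re χ(d)`) and `t ≥ √q(1 + log q)`: `Σ_{n ≤ t} r(n) ≤ Re L(1,χ)·t + 5·√(√q(1+log q)·t)`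
— Pintz's Lemma 1 (`j = 1`; tree-proved, two-sided) with the tree's Pólya–Vinogradov partial-sum bound
`|Σ_{n ≤ M} χ(n)| ≤ √q(1 + log q)`. [cite: Pintz1977ElementaryVIII, Lemma 1 (3.9) p. 92] -/
theorem sum_charDivisorSum_le (hq : 2 ≤ q) (hprim : χ.IsPrimitive) {t : ℝ}
    (ht : Real.sqrt q * (1 + Real.log q) ≤ t) :
    ∑ n ∈ Ioc 0 ⌊t⌋₊, charDivisorSum χ n ≤
      (χ.LFunction 1).re * t + 5 * Real.sqrt (Real.sqrt q * (1 + Real.log q) * t) := by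
  have hχ1 : χ ≠ 1 := by
    rintro rfl
    rw [DirichletCharacter.isPrimitive_def, DirichletCharacter.conductor_one] at hprim
    omega
  have h := abs_sum_charDivisorSum_sub_le_of_partialSum_le χ hχ1 (one_le_pv hq)
    (norm_partialSum_le_polyaVinogradov χ hq hprim) ht
  linarith [(abs_le.mp h).2]

omit [NeZero q] in
/-- For a quadratic `χ`, `N ≥ 1` and a set `U` of primes `≤ N`: `1 + Σ_{p ∈ U} r(p) ≤ Σ_{n ≤ N} r(n)`
(`r ≥ 0`, `r(1) = 1`, `insert 1 U ⊆ (0, N]`). [folklore] -/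
private theorem one_add_sum_le_sum (hq2 : χ ^ 2 = 1) {N : ℕ} (hN : 1 ≤ N) {U : Finset ℕ}
    (hU : ∀ p ∈ U, p.Prime ∧ p ≤ N) :
    1 + ∑ p ∈ U, charDivisorSum χ p ≤ ∑ n ∈ Ioc 0 N, charDivisorSum χ n := by
  classical
  have h1U : (1 : ℕ) ∉ U := fun h => Nat.not_prime_one (hU 1 h).1
  have hsub : insert 1 U ⊆ Ioc 0 N := by
    rw [insert_subset_iff]
    exact ⟨by rw [mem_Ioc]; omega, fun p hp => by rw [mem_Ioc]; exact ⟨(hU p hp).1.pos, (hU p hp).2⟩⟩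
  calc 1 + ∑ p ∈ U, charDivisorSum χ p = ∑ n ∈ insert 1 U, charDivisorSum χ n := by
        rw [sum_insert h1U, charDivisorSum_one]
    _ ≤ ∑ n ∈ Ioc 0 N, charDivisorSum χ n :=
        sum_le_sum_of_subset_of_nonneg hsub fun n _ _ => charDivisorSum_nonneg χ hq2 n

omit [NeZero q] in
/-- Members of the prime filters used below are primes `≤ N`. [folklore] -/
private theorem prime_le_of_mem_filter {N : ℕ} {P : ℕ → Prop} [DecidablePred P] {p : ℕ}
    (hp : p ∈ (Iic N).filter (fun p : ℕ => p.Prime ∧ P p)) : p.Prime ∧ p ≤ N := by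
  rw [mem_filter, mem_Iic] at hp
  exact ⟨hp.2.1, hp.1⟩

/-- **Pintz's «most primes are inert» in count form, explicit and unconditional.** For a primitive
quadratic character `χ` mod `q ≥ 2` and `t ≥ √q(1 + log q)`:
`#{p ≤ t prime : χ(p) ≠ −1} ≤ Re L(1,χ)·t + 5·√(√q(1+log q)·t)` — all but `L(1,χ)·t +
O(q^{1/4}√(t log q))` of the primes up to `t` satisfy `χ(p) = −1` (at such primes `r(p) = 1 + χ(p) ≥ 1`).
Non-trivial precisely when `L(1,χ) = o(1/log t)` — the illusory regime of Pintz's (1.25),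
`L(1) ≤ 1/log²D`, `t = D^A`. [cite: Pintz1976ElementaryII, Theorem 4 pp. 277–278 (the phenomenon, in count form)] -/
theorem card_primes_not_inert_le (hq : 2 ≤ q) (hprim : χ.IsPrimitive) (hquad : χ.IsQuadratic)
    {t : ℝ} (ht : Real.sqrt q * (1 + Real.log q) ≤ t) :
    (((Iic ⌊t⌋₊).filter (fun p : ℕ => p.Prime ∧ χ (p : ZMod q) ≠ -1)).card : ℝ) ≤
      (χ.LFunction 1).re * t + 5 * Real.sqrt (Real.sqrt q * (1 + Real.log q) * t) := by
  set S := (Iic ⌊t⌋₊).filter (fun p : ℕ => p.Prime ∧ χ (p : ZMod q) ≠ -1) with hS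
  have hN : 1 ≤ ⌊t⌋₊ := Nat.le_floor (by simpa using (one_le_pv hq).trans ht)
  have h1 := one_add_sum_le_sum χ hquad.sq_eq_one hN (U := S) fun p hp => prime_le_of_mem_filter hp
  have h2 := sum_charDivisorSum_le χ hq hprim ht
  -- `#S ≤ Σ_{p ∈ S} r(p)` since `r(p) = 1 + χ(p) ≥ 1` for `χ(p) ∈ {0, 1}`
  have h3 : (S.card : ℝ) ≤ ∑ p ∈ S, charDivisorSum χ p := by
    rw [card_eq_sum_ones, Nat.cast_sum, Nat.cast_one]
    refine sum_le_sum fun p hp => ?_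
    have hp' := hp
    rw [hS, mem_filter] at hp'
    rw [charDivisorSum_prime χ hquad.sq_eq_one hp'.2.1, reChar_apply χ hp'.2.1.ne_zero]
    rcases hquad (p : ZMod q) with h0 | h1 | hm1
    · rw [h0]; simp
    · rw [h1]; simp
    · exact absurd hm1 hp'.2.2
  linarith

/-- **The split-prime ceiling.** For a primitive quadratic character `χ` mod `q ≥ 2` and
`t ≥ √q(1 + log q)`: `#{p ≤ t prime : χ(p) = 1} ≤ Re L(1,χ)·t/2 + (5/2)·√(√q(1+log q)·t)` (at split
primes `r(p) = 2`). [cite: Pintz1976ElementaryII, Theorem 4 pp. 277–278 (the phenomenon, in count form)] -/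
theorem card_primes_split_le (hq : 2 ≤ q) (hprim : χ.IsPrimitive) (hquad : χ.IsQuadratic)
    {t : ℝ} (ht : Real.sqrt q * (1 + Real.log q) ≤ t) :
    (((Iic ⌊t⌋₊).filter (fun p : ℕ => p.Prime ∧ χ (p : ZMod q) = 1)).card : ℝ) ≤
      (χ.LFunction 1).re * t / 2 + 5 / 2 * Real.sqrt (Real.sqrt q * (1 + Real.log q) * t) := by
  set T := (Iic ⌊t⌋₊).filter (fun p : ℕ => p.Prime ∧ χ (p : ZMod q) = 1) with hT
  have hN : 1 ≤ ⌊t⌋₊ := Nat.le_floor (by simpa using (one_le_pv hq).trans ht)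
  have h1 := one_add_sum_le_sum χ hquad.sq_eq_one hN (U := T) fun p hp => prime_le_of_mem_filter hp
  have h2 := sum_charDivisorSum_le χ hq hprim ht
  -- `2·#T = Σ_{p ∈ T} r(p)` since `r(p) = 1 + χ(p) = 2` on `T`
  have h3 : 2 * (T.card : ℝ) = ∑ p ∈ T, charDivisorSum χ p := by
    rw [card_eq_sum_ones, Nat.cast_sum, Nat.cast_one, mul_sum]
    refine sum_congr rfl fun p hp => ?_
    have hp' := hp
    rw [hT, mem_filter] at hp'
    rw [charDivisorSum_prime χ hquad.sq_eq_one hp'.2.1, reChar_apply χ hp'.2.1.ne_zero, hp'.2.2]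
    norm_num
  linarith

/-- **In `L(1)`-hypothesis currency** (Pintz's (1.25) is `C = 1`, `B = 2`; Dunn–Kerr–Shparlinski–
Zaharescu's (1.5) is `B = 10`): if `‖L(1,χ)‖ ≤ C/(log q)^B` then for `t ≥ √q(1 + log q)`
`#{p ≤ t prime : χ(p) = 1} ≤ C·t/(2 (log q)^B) + (5/2)·√(√q(1+log q)·t)`.
[cite: Pintz1976ElementaryII, Theorem 4 pp. 277–278 (hypothesis (1.25))] -/
theorem card_primes_split_le_of_norm_LFunction_one_le (hq : 2 ≤ q) (hprim : χ.IsPrimitive)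
    (hquad : χ.IsQuadratic) {C : ℝ} {B : ℕ} (hL : ‖χ.LFunction 1‖ ≤ C / Real.log q ^ B) {t : ℝ}
    (ht : Real.sqrt q * (1 + Real.log q) ≤ t) :
    (((Iic ⌊t⌋₊).filter (fun p : ℕ => p.Prime ∧ χ (p : ZMod q) = 1)).card : ℝ) ≤
      C * t / (2 * Real.log q ^ B) + 5 / 2 * Real.sqrt (Real.sqrt q * (1 + Real.log q) * t) := by
  have h1 := card_primes_split_le χ hq hprim hquad ht
  have ht0 : 0 ≤ t := le_trans (by linarith [one_le_pv hq]) ht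
  have h2 := mul_le_mul_of_nonneg_right ((Complex.re_le_norm _).trans hL) ht0
  have h3 : C / Real.log q ^ B * t / 2 = C * t / (2 * Real.log q ^ B) := by ring
  linarith

/-- **On the column's zero-side predicate.** If `χ` mod `q ≥ 232` carries a Siegel zero of quality
`η ≥ 40` (Tao–Teräväinen: `χ` primitive quadratic, `L(1 − 1/(η log q), χ) = 0`), then for every
`t ≥ √q(1 + log q)`: `#{p ≤ t prime : χ(p) = 1} ≤ (log q/η)·t/2 + (5/2)·√(√q(1+log q)·t)` — by the
kernel's explicit Montgomery–Vaughan (11.10), `‖L(1,χ)‖·log q ≤ (log q)²/η`. A zero of quality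
`η ≫ log q · log t` leaves only a vanishing proportion of the primes `p ≤ t` split.
[cite: TaoTeravainen2021, Definition 1.4] [cite: MontgomeryVaughan2007, Theorem 11.4 (11.10)] -/
theorem card_primes_split_le_of_isSiegelZero (hq : 232 ≤ q) {η : ℝ} (hS : IsSiegelZero χ η)
    (h40 : 40 ≤ η) {t : ℝ} (ht : Real.sqrt q * (1 + Real.log q) ≤ t) :
    (((Iic ⌊t⌋₊).filter (fun p : ℕ => p.Prime ∧ χ (p : ZMod q) = 1)).card : ℝ) ≤
      Real.log q / η * t / 2 + 5 / 2 * Real.sqrt (Real.sqrt q * (1 + Real.log q) * t) := by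
  have hq2 : 2 ≤ q := by omega
  have h1 := card_primes_split_le χ hq2 hS.1 hS.2.1 ht
  have ht0 : 0 ≤ t := le_trans (by linarith [one_le_pv hq2]) ht
  have hη : 0 < η := by linarith
  have hlog : 0 < Real.log q := Real.log_pos (by exact_mod_cast (show 1 < q by omega))
  have hkey := RealZeroRepulsion.isSiegelZero_eta_le_log_sq_div hq hS h40
  -- `Re L(1) ≤ ‖L(1)‖ ≤ log q/η`
  have hnorm : ‖χ.LFunction 1‖ ≤ Real.log q / η := by
    rw [le_div_iff₀ hη]
    refine le_of_mul_le_mul_right ?_ hlog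
    have := mul_le_mul_of_nonneg_right hkey hη.le
    rw [div_mul_cancel₀ _ hη.ne'] at this
    nlinarith
  have h2 := mul_le_mul_of_nonneg_right ((Complex.re_le_norm _).trans hnorm) ht0
  linarith

end SplitPrimeCeiling

/-! ## Part 2. Field level: `N_q(P)` of Dunn–Kerr–Shparlinski–Zaharescu -/

namespace DKSZ2020

open SplitPrimeCeiling

variable {K : Type*} [Field K] [NumberField K]

/-- For a quadratic field with odd discriminant: `d_K ≡ 1 (mod 4)` and `jacobiChar |d_K|` is
primitive (`|d_K|` odd squarefree). [folklore] -/
private theorem odd_discr_basic (h2 : finrank ℚ K = 2) (hodd : Odd (NumberField.discr K)) :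
    NumberField.discr K % 4 = 1 ∧ (jacobiChar (NumberField.discr K).natAbs).IsPrimitive := by
  rcases isFundamentalDiscriminant_discr (K := K) h2 with ⟨h1, hsqf, -⟩ | ⟨h4, -, -⟩
  · exact ⟨h1, isPrimitive_jacobiChar (Int.natAbs_odd.mpr hodd) (Int.squarefree_natAbs.mpr hsqf)⟩
  · exfalso
    rcases hodd with ⟨k, hk⟩
    omega

/-- **The decomposition law as a count identity.** For a quadratic field `K` with odd discriminant
and every real `P`: `#{p ≤ P prime : p splits in 𝓞_K} = #{p ≤ P prime : χ(p) = 1}`,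
`χ = jacobiChar |d_K| = (d_K/·)` (odd `p`: `p` splits iff `(d_K/p) = 1` iff `(p/|d_K|) = 1` by
reciprocity for `d_K ≡ 1 (mod 4)`; `p = 2`: `2` splits iff `d_K ≡ 1 (mod 8)` iff `(2/|d_K|) = 1`).
[cite: NeukirchANT1999, Ch. I §8 Proposition 8.5 (decomposition law in quadratic fields)] -/
theorem splitPrimeCount_eq_card (h2 : finrank ℚ K = 2) (hodd : Odd (NumberField.discr K)) (P : ℝ) :
    splitPrimeCount K P =
      ((Iic ⌊P⌋₊).filter (fun p : ℕ => p.Prime ∧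
        jacobiChar (NumberField.discr K).natAbs (p : ZMod (NumberField.discr K).natAbs) = 1)).card := by
  obtain ⟨h1, -⟩ := odd_discr_basic h2 hodd
  rw [splitPrimeCount]
  congr 1
  refine filter_congr fun p _ => ?_
  simp only [jacobiChar_natCast, Int.cast_eq_one]
  refine and_congr_right fun hp => ?_
  by_cases hp2 : p = 2
  · subst hp2
    rw [show ((2 : ℕ) : ℤ) = 2 from rfl, jacobiSym_two_natAbs_eq_one_iff h1]
    exact ncard_primesOver_two_eq_two_iff h2
  · rw [jacobiSym_natAbs_eq_of_emod_four_eq_one h1 (hp.odd_of_ne_two hp2)]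
    exact ncard_primesOver_eq_two_iff_jacobiSym h2 hp hp2

/-- `d_K = −q` with `q` odd: `|d_K| = q` and `d_K` is odd. [folklore] -/
private theorem natAbs_eq_and_odd {q : ℕ} (hd : NumberField.discr K = -(q : ℤ)) (hodd : Odd q) :
    (NumberField.discr K).natAbs = q ∧ Odd (NumberField.discr K) := by
  refine ⟨by rw [hd, Int.natAbs_neg, Int.natAbs_natCast], ?_⟩
  rw [hd, Int.odd_iff]
  rcases hodd with ⟨k, hk⟩
  omega

/-- Transport of the character-level ceilings along `|d_K| = q`: every bound proved for all primitive
quadratic characters mod `q` holds for the split-prime count of `K`. [folklore] -/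
private theorem splitPrimeCount_le_of_forall (h2 : finrank ℚ K = 2) {q : ℕ}
    (hd : NumberField.discr K = -(q : ℤ)) (hodd : Odd q) {P R : ℝ}
    (H : ∀ (m : ℕ) [NeZero m] (χ : DirichletCharacter ℂ m), m = q → χ.IsPrimitive → χ.IsQuadratic →
      χ.LFunction 1 = (jacobiChar (NumberField.discr K).natAbs).LFunction 1 →
      (((Iic ⌊P⌋₊).filter (fun p : ℕ => p.Prime ∧ χ (p : ZMod m) = 1)).card : ℝ) ≤ R) :
    (splitPrimeCount K P : ℝ) ≤ R := by
  obtain ⟨hn, hoddD⟩ := natAbs_eq_and_odd hd hodd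
  obtain ⟨-, hprim⟩ := odd_discr_basic h2 hoddD
  rw [splitPrimeCount_eq_card h2 hoddD]
  exact H _ _ hn hprim isQuadratic_jacobiChar rfl

/-- **The unconditional ceiling for `N_q(P)`, explicit.** For an imaginary quadratic field `K` with
odd `d_K = −q < −4` and every `P ≥ √q(1 + log q)`:
`N_q(P) = #{p ≤ P : p splits in K} ≤ (π h_K/(2√q))·P + (5/2)·√(√q(1+log q)·P)` (the split-prime
ceiling for `χ = (−q/·)` and the class number formula `L(1,χ) = π h_K/√q`, `w_K = 2`). Compare
Dunn–Kerr–Shparlinski–Zaharescu's Theorem 5: `N_q(P) ≥ c(ε) h_K P/(√q (log q)²)` on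
`q^{1/2+ε} ≤ P ≤ q` under `L(1,χ) = O((log q)^{−10})`.
[cite: DunnKerrShparlinskiZaharescu2020, §1.2 Theorem 5 (the matching unconditional upper bound)]
[cite: NeukirchANT1999, Ch. VII §5 (5.11)] -/
theorem splitPrimeCount_le (h2 : finrank ℚ K = 2) {q : ℕ} (hd : NumberField.discr K = -(q : ℤ))
    (hodd : Odd q) (hq : 5 ≤ q) {P : ℝ} (hP : Real.sqrt q * (1 + Real.log q) ≤ P) :
    (splitPrimeCount K P : ℝ) ≤
      Real.pi * classNumber K / (2 * Real.sqrt q) * P +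
        5 / 2 * Real.sqrt (Real.sqrt q * (1 + Real.log q) * P) := by
  obtain ⟨-, hoddD⟩ := natAbs_eq_and_odd hd hodd
  -- class number formula: `Re L(1, χ) = π h/√q`
  have hdneg : NumberField.discr K < -4 := by rw [hd]; omega
  have hcnf := LFunction_jacobiChar_one_eq_of_discr_neg h2 hoddD (by omega)
  have habs : |(NumberField.discr K : ℝ)| = q := by
    rw [hd]; push_cast; rw [abs_neg, abs_of_nonneg (by positivity)]
  rw [torsionOrder_eq_two_of_discr_lt_neg_four h2 hdneg, habs] at hcnf
  refine splitPrimeCount_le_of_forall h2 hd hodd fun m _ χ hm hp hqd hL => ?_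
  subst hm
  have hre : (χ.LFunction 1).re = Real.pi * classNumber K / Real.sqrt m := by
    rw [hL, hcnf, Complex.ofReal_re]; push_cast; ring
  have h := card_primes_split_le χ (by omega) hp hqd hP
  rw [hre] at h
  have : Real.pi * classNumber K / Real.sqrt m * P / 2 =
      Real.pi * classNumber K / (2 * Real.sqrt m) * P := by ring
  linarith

/-- **The ceiling on the zero side.** Same `K` (`d_K = −q`, `q ≥ 232` odd); if `χ = jacobiChar q`
carries a Siegel zero of quality `η ≥ 40`, then for `P ≥ √q(1 + log q)`:
`N_q(P) ≤ (log q/η)·P/2 + (5/2)·√(√q(1+log q)·P)`.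
[cite: DunnKerrShparlinskiZaharescu2020, §1.2 Theorem 5 (the matching unconditional upper bound)]
[cite: TaoTeravainen2021, Definition 1.4] -/
theorem splitPrimeCount_le_of_isSiegelZero (h2 : finrank ℚ K = 2) {q : ℕ}
    (hd : NumberField.discr K = -(q : ℤ)) (hodd : Odd q) (hq : 232 ≤ q) {η : ℝ}
    (hS : IsSiegelZero (jacobiChar (NumberField.discr K).natAbs) η) (h40 : 40 ≤ η) {P : ℝ}
    (hP : Real.sqrt q * (1 + Real.log q) ≤ P) :
    (splitPrimeCount K P : ℝ) ≤
      Real.log q / η * P / 2 + 5 / 2 * Real.sqrt (Real.sqrt q * (1 + Real.log q) * P) := by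
  obtain ⟨hn, hoddD⟩ := natAbs_eq_and_odd hd hodd
  rw [splitPrimeCount_eq_card h2 hoddD]
  have key : ∀ (m : ℕ) [NeZero m] (χ : DirichletCharacter ℂ m), m = q → IsSiegelZero χ η →
      (((Iic ⌊P⌋₊).filter (fun p : ℕ => p.Prime ∧ χ (p : ZMod m) = 1)).card : ℝ) ≤
        Real.log q / η * P / 2 + 5 / 2 * Real.sqrt (Real.sqrt q * (1 + Real.log q) * P) := by
    intro m _ χ hm hSm
    subst hm
    exact card_primes_split_le_of_isSiegelZero χ hq hSm h40 hP
  exact key _ _ hn hS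

/-- The side condition is implied by DKSZ's window for large `q`: for every `ε > 0` there is `q₁` with
`√q(1 + log q) ≤ q^{1/2+ε}` for all `q ≥ q₁` (`log q = o(q^ε)`). [folklore] -/
private theorem exists_pv_le_rpow {ε : ℝ} (hε : 0 < ε) :
    ∃ q₁ : ℕ, ∀ q : ℕ, q₁ ≤ q → Real.sqrt q * (1 + Real.log q) ≤ (q : ℝ) ^ (1 / 2 + ε) := by
  have h1 : ∀ᶠ x : ℝ in Filter.atTop, ‖Real.log x‖ ≤ 1 / 2 * ‖x ^ ε‖ :=
    (isLittleO_log_rpow_atTop hε).bound (by norm_num)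
  have h2 : ∀ᶠ x : ℝ in Filter.atTop, 2 ≤ x ^ ε := (tendsto_rpow_atTop hε).eventually_ge_atTop 2
  obtain ⟨a, ha⟩ := Filter.eventually_atTop.mp (h1.and (h2.and (Filter.eventually_ge_atTop 1)))
  refine ⟨⌈a⌉₊, fun q hq => ?_⟩
  obtain ⟨hb, hge, hx1⟩ := ha q ((Nat.le_ceil a).trans (by exact_mod_cast hq))
  have hq0 : (0 : ℝ) ≤ q := by linarith
  rw [Real.norm_eq_abs, Real.norm_eq_abs, abs_of_nonneg (Real.rpow_nonneg hq0 ε)] at hb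
  have hsum : 1 + Real.log q ≤ (q : ℝ) ^ ε := by linarith [(le_abs_self _).trans hb]
  calc Real.sqrt q * (1 + Real.log q) ≤ Real.sqrt q * (q : ℝ) ^ ε :=
        mul_le_mul_of_nonneg_left hsum (Real.sqrt_nonneg _)
    _ = (q : ℝ) ^ (1 / 2 + ε) := by
        rw [Real.sqrt_eq_rpow, ← Real.rpow_add' hq0 (by linarith)]

/-- **Theorem 5 and the ceiling on one window** (PROVED modulo the named fact `dksz2020_theorem5`):
for every `ε > 0` and `C` there are `c > 0` and `q₀` such that for every quadratic `K` with `d_K = −q`,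
`q ≥ q₀` prime, `q ≡ 3 (mod 4)`, `‖L(1, χ)‖ ≤ C/(log q)^{10}` (`χ = jacobiChar q = (−q/·)`) and every
`q^{1/2+ε} ≤ P ≤ q`:
`c·h_K·P/(√q (log q)²) ≤ N_q(P) ≤ (C/2)·P/(log q)^{10} + (5/2)·√(√q(1+log q)·P)`.
In the illusory regime the split primes `p ≤ P` are thus a vanishing proportion of all primes (the
ceiling, unconditional given (1.5)), yet not absent (Theorem 5).
[cite: DunnKerrShparlinskiZaharescu2020, §1.2 Theorem 5 and §5.3] -/
theorem splitPrimeCount_two_sided (h5 : dksz2020_theorem5) {ε : ℝ} (hε : 0 < ε) (C : ℝ) :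
    ∃ c : ℝ, 0 < c ∧ ∃ q₀ : ℕ, ∀ (K : Type) [Field K] [NumberField K], finrank ℚ K = 2 →
      ∀ q : ℕ, q.Prime → q % 4 = 3 → q₀ ≤ q → NumberField.discr K = -(q : ℤ) →
        ‖(jacobiChar (NumberField.discr K).natAbs).LFunction 1‖ ≤ C / Real.log q ^ 10 →
          ∀ P : ℝ, (q : ℝ) ^ (1 / 2 + ε) ≤ P → P ≤ q →
            c * (classNumber K : ℝ) * P / (Real.sqrt q * Real.log q ^ 2) ≤ (splitPrimeCount K P : ℝ) ∧
            (splitPrimeCount K P : ℝ) ≤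
              C * P / (2 * Real.log q ^ 10) + 5 / 2 * Real.sqrt (Real.sqrt q * (1 + Real.log q) * P) := by
  obtain ⟨c, hc, q₀, H⟩ := h5 ε hε C
  obtain ⟨q₁, hq₁⟩ := exists_pv_le_rpow hε
  refine ⟨c, hc, max q₀ (max q₁ 3), fun K _ _ h2 q hq hq4 hq₀ hd hL P hP1 hP2 => ⟨?_, ?_⟩⟩
  · exact H K h2 q hq hq4 (le_trans (le_max_left _ _) hq₀) hd hL P hP1 hP2
  · have hq₁' : q₁ ≤ q := le_trans ((le_max_left _ _).trans (le_max_right _ _)) hq₀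
    have hq3 : 3 ≤ q := le_trans ((le_max_right _ _).trans (le_max_right _ _)) hq₀
    have hP : Real.sqrt q * (1 + Real.log q) ≤ P := (hq₁ q hq₁').trans hP1
    refine splitPrimeCount_le_of_forall h2 hd (hq.odd_of_ne_two (by omega))
      fun m _ χ hm hp hqd hLm => ?_
    subst hm
    exact card_primes_split_le_of_norm_LFunction_one_le χ (by omega) hp hqd (hLm ▸ hL) hP

end DKSZ2020

end Literature.NumberTheory.LFunctions

end
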